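import Summits.NavierStokesRegularity.NavierStokesRegularity.Theorems.EfficiencyFloorRigidExitLateExit
import HarnessLib

/-!
# Route `EfficiencyFloor`, support `RigidExit` (stmt-25513) on the `ProductionEfficiencyDecay` ladder (stmt-22866):
# late exit from the maximiser set — THE EXACT PROPERTY OF THE MAXIMISER SET THAT IS USED

Helper file (`--supports stmt-NavierStokesRegularity-22866 --as helper`), sequel to `…RigidExitLateExit` (p835741). There, clause (a)
of `MaximiserSetRigidity` (finitely many maximiser orbits) gives a late window `[s₀,T)` free of maximiser slices along every blow-up of
the route's class. Finiteness enters only through ONE consequence — the normalised-maximiser set is BOUNDED IN THE CRITICAL NORM `L³`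
(a symmetry-invariant quantity) — and this file records the late exit under that weaker hypothesis, which survives a continuum of
maximiser orbits (the failure mode filed for stmt-25512) as long as `‖m‖₃` stays bounded on it:

* `eventually_not_normalisedMaximiser_of_L3bound` / `exists_late_window_not_normalisedMaximiser_of_L3bound`: `L³` bound on the
  maximiser set ⟹ eventually (resp. on a late window) no slice `u(t)` is a normalised maximiser (route clause verbatim);
* `L3bound_of_classification`: the classification half of clause (a) ⟹ the `L³` bound (`‖l•R(m(l•R⁻¹(·−a)))‖₃ = ‖m‖₃` and
  `H² ⊂ L³`).

HONEST FRAMING: statements about a HYPOTHETICAL blow-up; `RigidExit`, clause (a), `NearMaximiserBoundedAmplification`, `LerayFloorGap`,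
`ProductionEfficiencyDecay` (stmt-22866) and Navier–Stokes regularity stay OPEN; no summit statement is proved. [folklore]
-/

-- the problem directory repeats the summit name (`NavierStokesRegularity/NavierStokesRegularity`)
set_option linter.dupNamespace false

noncomputable section

open Set Filter MeasureTheory Topology Function
open scoped InnerProductSpace RealInnerProductSpace ENNReal NNReal
open Literature.Analysis.FluidPDE

namespace Summit.NavierStokesRegularity.NavierStokesRegularity.Theorems

namespace RigidExit

namespace LateExit

/-! ## `L³`-boundedness of the maximiser set modulo symmetry suffices -/

/-- **No maximiser slice at late times, from an `L³` bound on the maximiser set.** If every normalised maximiser (for `c, ν₀`;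
route clause verbatim) has `‖m‖₃ ≤ M` for one finite `M`, then eventually as `t ↑ T` the slice `u(t)` of a maximal classical
Leray–Hopf rapidly-decaying-datum solution is not a normalised maximiser. [folklore] -/
theorem eventually_not_normalisedMaximiser_of_L3bound {ν T : ℝ} (hν : 0 < ν) (hT : 0 < T)
    {u : ℝ → EuclideanSpace ℝ (Fin 3) → EuclideanSpace ℝ (Fin 3)} {p : ℝ → EuclideanSpace ℝ (Fin 3) → ℝ}
    (hmax : IsMaximalSmoothSolution ν 0 u p T) (hLH : IsLerayHopfOn T ν 0 (u 0) u)
    (hdec : HasRapidSpatialDecay (u 0)) {c ν₀ : ℝ}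
    (hB : ∃ M : ℝ≥0∞, M < ⊤ ∧ ∀ m : EuclideanSpace ℝ (Fin 3) → EuclideanSpace ℝ (Fin 3), ((ContDiff ℝ (⊤ : ℕ∞) m ∧ VectorCalculus.IsDivFree m ∧
        (∫⁻ x, ‖iteratedFDeriv ℝ 0 m x‖ₑ ^ 2 < ⊤) ∧ (∫⁻ x, ‖iteratedFDeriv ℝ 1 m x‖ₑ ^ 2 < ⊤) ∧
        (∫⁻ x, ‖iteratedFDeriv ℝ 2 m x‖ₑ ^ 2 < ⊤)) ∧ 0 < (∫ x, ‖curl m x‖ ^ 2) ∧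
        (∫ x, ⟪curl m x, fderiv ℝ m x (curl m x)⟫_ℝ) = c * (∫ x, ‖curl m x‖ ^ 2) ^ (3 / 4 : ℝ) *
          (∫ x, frobeniusNormSq (fderiv ℝ (curl m) x)) ^ (3 / 4 : ℝ) ∧
        (∫ x, frobeniusNormSq (fderiv ℝ (curl m) x)) = 81 * c ^ 4 / (256 * ν₀ ^ 4) * (∫ x, ‖curl m x‖ ^ 2) ^ 3) →
        eLpNorm m 3 volume ≤ M) :
    ∀ᶠ t in 𝓝[<] T, ¬ ((ContDiff ℝ (⊤ : ℕ∞) (u t) ∧ VectorCalculus.IsDivFree (u t) ∧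
        (∫⁻ x, ‖iteratedFDeriv ℝ 0 (u t) x‖ₑ ^ 2 < ⊤) ∧ (∫⁻ x, ‖iteratedFDeriv ℝ 1 (u t) x‖ₑ ^ 2 < ⊤) ∧
        (∫⁻ x, ‖iteratedFDeriv ℝ 2 (u t) x‖ₑ ^ 2 < ⊤)) ∧ 0 < (∫ x, ‖curl (u t) x‖ ^ 2) ∧
        (∫ x, ⟪curl (u t) x, fderiv ℝ (u t) x (curl (u t) x)⟫_ℝ) = c * (∫ x, ‖curl (u t) x‖ ^ 2) ^ (3 / 4 : ℝ) *
          (∫ x, frobeniusNormSq (fderiv ℝ (curl (u t)) x)) ^ (3 / 4 : ℝ) ∧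
        (∫ x, frobeniusNormSq (fderiv ℝ (curl (u t)) x)) = 81 * c ^ 4 / (256 * ν₀ ^ 4) * (∫ x, ‖curl (u t) x‖ ^ 2) ^ 3) := by
  obtain ⟨M, hM, hbound⟩ := hB
  filter_upwards [eventually_lt_eLpNorm_three hν hT hmax hLH hdec hM] with t ht hNM
  exact ((hbound (u t) hNM).trans_lt ht).false

/-- **A late window free of maximiser slices, from an `L³` bound on the maximiser set.** [folklore] -/
theorem exists_late_window_not_normalisedMaximiser_of_L3bound {ν T : ℝ} (hν : 0 < ν) (hT : 0 < T)
    {u : ℝ → EuclideanSpace ℝ (Fin 3) → EuclideanSpace ℝ (Fin 3)} {p : ℝ → EuclideanSpace ℝ (Fin 3) → ℝ}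
    (hmax : IsMaximalSmoothSolution ν 0 u p T) (hLH : IsLerayHopfOn T ν 0 (u 0) u)
    (hdec : HasRapidSpatialDecay (u 0)) {c ν₀ : ℝ}
    (hB : ∃ M : ℝ≥0∞, M < ⊤ ∧ ∀ m : EuclideanSpace ℝ (Fin 3) → EuclideanSpace ℝ (Fin 3), ((ContDiff ℝ (⊤ : ℕ∞) m ∧ VectorCalculus.IsDivFree m ∧
        (∫⁻ x, ‖iteratedFDeriv ℝ 0 m x‖ₑ ^ 2 < ⊤) ∧ (∫⁻ x, ‖iteratedFDeriv ℝ 1 m x‖ₑ ^ 2 < ⊤) ∧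
        (∫⁻ x, ‖iteratedFDeriv ℝ 2 m x‖ₑ ^ 2 < ⊤)) ∧ 0 < (∫ x, ‖curl m x‖ ^ 2) ∧
        (∫ x, ⟪curl m x, fderiv ℝ m x (curl m x)⟫_ℝ) = c * (∫ x, ‖curl m x‖ ^ 2) ^ (3 / 4 : ℝ) *
          (∫ x, frobeniusNormSq (fderiv ℝ (curl m) x)) ^ (3 / 4 : ℝ) ∧
        (∫ x, frobeniusNormSq (fderiv ℝ (curl m) x)) = 81 * c ^ 4 / (256 * ν₀ ^ 4) * (∫ x, ‖curl m x‖ ^ 2) ^ 3) →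
        eLpNorm m 3 volume ≤ M) :
    ∃ s₀ ∈ Ioo 0 T, ∀ τ ∈ Ico s₀ T, ¬ ((ContDiff ℝ (⊤ : ℕ∞) (u τ) ∧ VectorCalculus.IsDivFree (u τ) ∧
        (∫⁻ x, ‖iteratedFDeriv ℝ 0 (u τ) x‖ₑ ^ 2 < ⊤) ∧ (∫⁻ x, ‖iteratedFDeriv ℝ 1 (u τ) x‖ₑ ^ 2 < ⊤) ∧
        (∫⁻ x, ‖iteratedFDeriv ℝ 2 (u τ) x‖ₑ ^ 2 < ⊤)) ∧ 0 < (∫ x, ‖curl (u τ) x‖ ^ 2) ∧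
        (∫ x, ⟪curl (u τ) x, fderiv ℝ (u τ) x (curl (u τ) x)⟫_ℝ) = c * (∫ x, ‖curl (u τ) x‖ ^ 2) ^ (3 / 4 : ℝ) *
          (∫ x, frobeniusNormSq (fderiv ℝ (curl (u τ)) x)) ^ (3 / 4 : ℝ) ∧
        (∫ x, frobeniusNormSq (fderiv ℝ (curl (u τ)) x)) = 81 * c ^ 4 / (256 * ν₀ ^ 4) * (∫ x, ‖curl (u τ) x‖ ^ 2) ^ 3) := by
  have hev := eventually_not_normalisedMaximiser_of_L3bound hν hT hmax hLH hdec hB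
  obtain ⟨s₁, hs₁T, hs₁⟩ := (mem_nhdsLT_iff_exists_Ioo_subset).1 hev
  have hs₁T' : s₁ < T := hs₁T
  refine ⟨max ((s₁ + T) / 2) (T / 2), ⟨lt_max_of_lt_right (by linarith), max_lt (by linarith) (by linarith)⟩,
    fun τ hτ => hs₁ ⟨?_, hτ.2⟩⟩
  have h1 : (s₁ + T) / 2 ≤ τ := (le_max_left _ _).trans hτ.1
  linarith

/-- **Clause (a)'s classification ⟹ the `L³` bound** (the only use of finiteness): finitely many admissible representatives up
to translation, linear isometry and scaling bound `‖m‖₃` on the whole normalised-maximiser set. [folklore] -/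
theorem L3bound_of_classification {c ν₀ : ℝ}
    (hA : ∃ (k : ℕ) (ms : Fin k → EuclideanSpace ℝ (Fin 3) → EuclideanSpace ℝ (Fin 3)),
      (∀ i, ContDiff ℝ (⊤ : ℕ∞) (ms i) ∧ VectorCalculus.IsDivFree (ms i) ∧ (∫⁻ x, ‖iteratedFDeriv ℝ 0 (ms i) x‖ₑ ^ 2 < ⊤) ∧
        (∫⁻ x, ‖iteratedFDeriv ℝ 1 (ms i) x‖ₑ ^ 2 < ⊤) ∧ (∫⁻ x, ‖iteratedFDeriv ℝ 2 (ms i) x‖ₑ ^ 2 < ⊤)) ∧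
      ∀ m : EuclideanSpace ℝ (Fin 3) → EuclideanSpace ℝ (Fin 3), ((ContDiff ℝ (⊤ : ℕ∞) m ∧ VectorCalculus.IsDivFree m ∧
        (∫⁻ x, ‖iteratedFDeriv ℝ 0 m x‖ₑ ^ 2 < ⊤) ∧ (∫⁻ x, ‖iteratedFDeriv ℝ 1 m x‖ₑ ^ 2 < ⊤) ∧
        (∫⁻ x, ‖iteratedFDeriv ℝ 2 m x‖ₑ ^ 2 < ⊤)) ∧ 0 < (∫ x, ‖curl m x‖ ^ 2) ∧
        (∫ x, ⟪curl m x, fderiv ℝ m x (curl m x)⟫_ℝ) = c * (∫ x, ‖curl m x‖ ^ 2) ^ (3 / 4 : ℝ) *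
          (∫ x, frobeniusNormSq (fderiv ℝ (curl m) x)) ^ (3 / 4 : ℝ) ∧
        (∫ x, frobeniusNormSq (fderiv ℝ (curl m) x)) = 81 * c ^ 4 / (256 * ν₀ ^ 4) * (∫ x, ‖curl m x‖ ^ 2) ^ 3) →
        ∃ (i : Fin k) (a : EuclideanSpace ℝ (Fin 3)) (R : EuclideanSpace ℝ (Fin 3) ≃ₗᵢ[ℝ] EuclideanSpace ℝ (Fin 3)) (l : ℝ),
          0 < l ∧ m = fun x => l • R (ms i (l • R.symm (x - a)))) :
    ∃ M : ℝ≥0∞, M < ⊤ ∧ ∀ m : EuclideanSpace ℝ (Fin 3) → EuclideanSpace ℝ (Fin 3), ((ContDiff ℝ (⊤ : ℕ∞) m ∧ VectorCalculus.IsDivFree m ∧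
        (∫⁻ x, ‖iteratedFDeriv ℝ 0 m x‖ₑ ^ 2 < ⊤) ∧ (∫⁻ x, ‖iteratedFDeriv ℝ 1 m x‖ₑ ^ 2 < ⊤) ∧
        (∫⁻ x, ‖iteratedFDeriv ℝ 2 m x‖ₑ ^ 2 < ⊤)) ∧ 0 < (∫ x, ‖curl m x‖ ^ 2) ∧
        (∫ x, ⟪curl m x, fderiv ℝ m x (curl m x)⟫_ℝ) = c * (∫ x, ‖curl m x‖ ^ 2) ^ (3 / 4 : ℝ) *
          (∫ x, frobeniusNormSq (fderiv ℝ (curl m) x)) ^ (3 / 4 : ℝ) ∧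
        (∫ x, frobeniusNormSq (fderiv ℝ (curl m) x)) = 81 * c ^ 4 / (256 * ν₀ ^ 4) * (∫ x, ‖curl m x‖ ^ 2) ^ 3) →
        eLpNorm m 3 volume ≤ M := by
  obtain ⟨k, ms, hms, hclass⟩ := hA
  have h3 : ∀ i, MemLp (ms i) 3 volume := fun i =>
    memLp_three_of_admissible (hms i).1 (hms i).2.2.1 (hms i).2.2.2.1 (hms i).2.2.2.2
  refine ⟨Finset.univ.sup fun i => eLpNorm (ms i) 3 volume,
    (Finset.sup_lt_iff (by simp)).2 fun i _ => (h3 i).eLpNorm_lt_top, fun m hNM => ?_⟩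
  obtain ⟨i, a, R, l, hl, heq⟩ := hclass m hNM
  rw [heq, eLpNorm_three_orbitSlice (ms i) a R hl]
  exact Finset.le_sup (f := fun i => eLpNorm (ms i) 3 volume) (Finset.mem_univ i)

end LateExit

end RigidExit

end Summit.NavierStokesRegularity.NavierStokesRegularity.Theorems

end
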